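import Summits.ResolutionOfSingularities.ResolutionOfSingularities.Theorems.EquisingularLiftEquisingularLiftNatDictAdaptedFramePrep
import Literature.AlgebraicGeometry.Resolution.StrictTransformIsBlowup
import Summits.ResolutionOfSingularities.ResolutionOfSingularities.Theorems.EquisingularLiftEquisingularLiftNatDirectionOfChartColumns
import Mathlib.LinearAlgebra.Matrix.NonsingularInverse
import Mathlib.RingTheory.Nakayama
import HarnessLib

/-!
# [OURS · L1 W4.5(b) · EL♮(3) · S6 (L) brick C2, bridge piece X1] The adapted frame in DICT currency

Crux chain w45b (cell `res-hironaka`), child EL♮(3) = stmt-ResolutionOfSingularities-20148; S6 (L) brick C2, bridge piece X1 of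
res-type-027 g15's cut (`L/res-type-027/Bridge-pieces.sig.lean` d74e4ef5f55702f7, signature VERBATIM; desk DEAL 2026-08-28T00:36:58Z).
At a point `z ∈ supp Ī ∩ W` of C1c's DICT chart (`W ≤ j₀⁻¹V`, `Ī(W) = (x|_W)` via `hĪ`, `𝒟'(W) = (d) + Ī(W)²` with `d = Σ α_j x_j|_W`):
an affine `W' ∋ z` inside `W`, a matrix `A ∈ GL₂(Γ(W'))` with row `0` equal to `α|_{W'}` and the frame `c = A · x|_{W'}` (so
`c₀ = d|_{W'}`) with `Ī(W') = (c₀, c₁)`, `c` quasi-regular in `Γ(G₀, W')`, `𝒟'(W') = (c₀) + Ī(W')²` (`exists_dictAdaptedFrame`).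
Proof (stalk level, then spread): with the socket frame `cz` at `z`, `𝒟'_z = (cz₀) + Ī_z² = (d)_z + Ī_z²` gives `d_z = λ cz₀ + q`,
`q ∈ Ī_z²`, and `1 − μλ ∈ Ī_z` by degree-one quasi-regularity of `cz`, so `λ` is a unit; hence `(d_z, cz₁)` generates `Ī_z` (Nakayama)
with `𝒟'_z = (d)_z + Ī_z²`. A section `g₁` of `cz₁` lies in `Ī` on a basic open `V₂ ∋ z` (`exists_basicOpen_forall_germ_mem_stalkIdeal`),
so `g₁ = Σ β_j x_j|` there; `A := (α|; β)` has `det A` a unit at `z` (`isUnit_det_of_span_pair_eq_matrix`, X1 prep), and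
`exists_affine_adaptedFrame_of_germs` (X1 prep) spreads the prescribed pair `(d|, g₁)` to an affine `W' ⊆ V₂ ∩ D(det A)`. Written by res-L1-w45b-stub-3 g7. OURS; NOT a statement of any
manuscript; AI-written, weaker than expert review. No `sorry`; standard axioms; DEF-FREE. `--supports stmt-ResolutionOfSingularities-20148 --as helper`.
[cite: Matsumura1987, §16] [cite: Hartshorne1977, Ch. II Prop. 5.4] (index only).
-/

set_option linter.dupNamespace false -- mandated namespace `Summit.<Summit>.<Problem>` of this single-conjunct summit

noncomputable section

open CategoryTheory AlgebraicGeometry TopologicalSpace IsLocalRing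
open Literature.AlgebraicGeometry.Resolution
open Literature.AlgebraicGeometry.Hironaka2017.S02Preliminaries
open AlgebraicGeometry.Scheme.IdealSheafData

namespace Summit.ResolutionOfSingularities.ResolutionOfSingularities.Cruxes.EquisingularLiftNat.Sections

open MvPolynomial in
/-- Degree-one quasi-regularity for a pair, first coordinate: `t · c₀ ∈ (c)² ⇒ t ∈ (c)`. [cite: Matsumura1987, §16 Definition p. 124] -/
theorem IsQuasiRegular.mem_of_mul_fst_mem_sq {R : Type} [CommRing R] {c : Fin 2 → R} (hc : IsQuasiRegular c) {t : R}
    (ht : t * c 0 ∈ Ideal.span (Set.range c) ^ 2) : t ∈ Ideal.span (Set.range c) := by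
  classical
  have h := (isQuasiRegular_def c).mp hc 1 (∑ j, C (![t, 0] j) * X j) (isHomogeneous_linearForm _) ?_ (Finsupp.single 0 1)
  · rw [coeff_linearForm] at h
    simpa using h
  · rw [eval_linearForm]
    simpa [Fin.sum_univ_two] using ht

/-- **X1 — the adapted frame in DICT currency.** See the module docstring. [OURS · L1 W4.5b · S6 (L) C2 X1; signature of res-type-027 g15] -/
theorem exists_dictAdaptedFrame {X₀ G₀ : Scheme.{0}} (j₀ : G₀ ⟶ X₀) [IsLocallyNoetherian G₀]
    (I : X₀.IdealSheafData) (Ī : G₀.IdealSheafData) (hĪ : I.comap j₀ = Ī) (𝒟' : G₀.IdealSheafData)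
    (hdir' : ∀ z ∈ Ī.support, ∃ c : Fin 2 → G₀.presheaf.stalk z,
      Ideal.span (Set.range c) = stalkIdeal Ī z ∧ IsQuasiRegular c ∧
      stalkIdeal 𝒟' z = Ideal.span {c 0} ⊔ Ideal.span {c 1 * c 1})
    (V : X₀.affineOpens) (x : Fin 2 → Γ(X₀, (V : X₀.Opens))) (hx : Ideal.span (Set.range x) = I.ideal V)
    (W : G₀.affineOpens) (hWV : (W : G₀.Opens) ≤ j₀ ⁻¹ᵁ (V : X₀.Opens)) (α : Fin 2 → Γ(G₀, (W : G₀.Opens)))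
    (h𝒟W : 𝒟'.ideal W = Ideal.span {∑ j, α j * j₀.appLE (V : X₀.Opens) (W : G₀.Opens) hWV (x j)} ⊔ (Ī.ideal W) ^ 2)
    (z : G₀) (hz : z ∈ Ī.support) (hzW : z ∈ (W : G₀.Opens)) :
    ∃ (W' : G₀.affineOpens) (_ : z ∈ (W' : G₀.Opens)) (hW' : (W' : G₀.Opens) ≤ W) (A : Matrix (Fin 2) (Fin 2) Γ(G₀, (W' : G₀.Opens)))
      (c : Fin 2 → Γ(G₀, (W' : G₀.Opens))),
      IsUnit A.det ∧ (∀ j, A 0 j = G₀.presheaf.map (homOfLE hW').op (α j)) ∧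
      (∀ i, c i = ∑ j, A i j * G₀.presheaf.map (homOfLE hW').op (j₀.appLE (V : X₀.Opens) (W : G₀.Opens) hWV (x j))) ∧
      Ideal.span (Set.range c) = Ī.ideal W' ∧ IsQuasiRegular c ∧ 𝒟'.ideal W' = Ideal.span {c 0} ⊔ (Ī.ideal W') ^ 2 := by
  classical
  set xW : Fin 2 → Γ(G₀, (W : G₀.Opens)) := fun j => j₀.appLE (V : X₀.Opens) (W : G₀.Opens) hWV (x j) with hxW
  set d : Γ(G₀, (W : G₀.Opens)) := ∑ j, α j * xW j with hd
  have hĪW : Ī.ideal W = Ideal.span (Set.range xW) := by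
    rw [← hĪ, ideal_comap_eq_map_of_le j₀ I V W hWV, ← hx, Ideal.map_span, ← Set.range_comp]
    rfl
  have hdĪ : d ∈ Ī.ideal W := by
    rw [hĪW]
    exact Ideal.sum_mem _ fun j _ => Ideal.mul_mem_left _ _ (Ideal.subset_span ⟨j, rfl⟩)
  -- at the stalk `z`: the socket frame `cz`, and `𝒟'_z = (cz₀) + Ī_z² = (d)_z + Ī_z²`
  obtain ⟨cz, hczspan, hczqr, hcz𝒟⟩ := hdir' z hz
  set φ := (G₀.presheaf.germ (W : G₀.Opens) z hzW).hom with hφ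
  have hĪz : stalkIdeal Ī z = (Ī.ideal W).map φ := stalkIdeal_eq_map_germ Ī W hzW
  have hĪzle : stalkIdeal Ī z ≤ maximalIdeal _ := (mem_support_iff_stalkIdeal_le Ī z).mp hz
  have h𝒟z : stalkIdeal 𝒟' z = Ideal.span {φ d} ⊔ stalkIdeal Ī z ^ 2 := by
    rw [stalkIdeal_eq_map_germ 𝒟' W hzW, h𝒟W, Ideal.map_sup, Ideal.map_span, Set.image_singleton, Ideal.map_pow, ← hĪz]
  have h𝒟z' : stalkIdeal 𝒟' z = Ideal.span {cz 0} ⊔ stalkIdeal Ī z ^ 2 := by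
    rw [hcz𝒟, ← hczspan, span_singleton_sup_sq_span_pair cz]
  have h1 : φ d ∈ Ideal.span {cz 0} ⊔ stalkIdeal Ī z ^ 2 := by
    rw [← h𝒟z', h𝒟z]; exact Ideal.mem_sup_left (Ideal.mem_span_singleton_self _)
  have h2 : cz 0 ∈ Ideal.span {φ d} ⊔ stalkIdeal Ī z ^ 2 := by
    rw [← h𝒟z, h𝒟z']; exact Ideal.mem_sup_left (Ideal.mem_span_singleton_self _)
  obtain ⟨_, hl, q, hq, hdq⟩ := Submodule.mem_sup.mp h1
  obtain ⟨l, rfl⟩ := Ideal.mem_span_singleton'.mp hl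
  obtain ⟨_, hm, q', hq', hcq⟩ := Submodule.mem_sup.mp h2
  obtain ⟨m, rfl⟩ := Ideal.mem_span_singleton'.mp hm
  -- `(1 - m l) cz₀ ∈ Ī_z²`, hence `1 - m l ∈ Ī_z ⊆ 𝔪_z`, so `l` is a unit
  have hkey : (1 - m * l) * cz 0 ∈ Ideal.span (Set.range cz) ^ 2 := by
    have e : (1 - m * l) * cz 0 = q' + m * q := by
      have e1 : cz 0 = m * φ d + q' := hcq.symm
      have e2 : φ d = l * cz 0 + q := hdq.symm
      linear_combination e1 + m * e2
    rw [e, hczspan]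
    exact Ideal.add_mem _ hq' (Ideal.mul_mem_left _ _ hq)
  have hlu : IsUnit l := by
    have hml : 1 - m * l ∈ maximalIdeal _ := hĪzle (hczspan ▸ IsQuasiRegular.mem_of_mul_fst_mem_sq hczqr hkey)
    exact isUnit_of_mul_isUnit_right (isUnit_of_mem_nonunits_one_sub_self _ hml)
  -- `(φ d, cz₁)` generates `Ī_z`
  haveI : IsNoetherianRing (G₀.presheaf.stalk z) := inferInstance
  have hpair : Ideal.span (Set.range ![φ d, cz 1]) = stalkIdeal Ī z := by
    have hle1 : Ideal.span (Set.range ![φ d, cz 1]) ≤ stalkIdeal Ī z := by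
      rw [Ideal.span_le]; rintro _ ⟨j, rfl⟩
      fin_cases j
      · exact hĪz ▸ Ideal.mem_map_of_mem φ hdĪ
      · exact hczspan ▸ Ideal.subset_span ⟨1, rfl⟩
    refine le_antisymm hle1 ?_
    refine Submodule.le_of_le_smul_of_le_jacobson_bot (I := maximalIdeal _) (IsNoetherian.noetherian _)
      (maximalIdeal_le_jacobson _) ?_
    rw [← hczspan, Ideal.span_le]
    rintro _ ⟨j, rfl⟩
    fin_cases j
    · obtain ⟨u, hu⟩ := hlu
      have e : cz 0 = ↑u⁻¹ * (φ d - q) := by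
        rw [← hdq, ← hu, add_sub_cancel_right, ← mul_assoc, Units.inv_mul, one_mul]
      change cz 0 ∈ _
      rw [e, mul_sub]
      refine Submodule.sub_mem _ ?_ ?_
      · exact Ideal.mem_sup_left (Ideal.mul_mem_left _ _ (Ideal.subset_span ⟨0, rfl⟩))
      · refine Ideal.mem_sup_right (Ideal.mul_mem_left _ _ ?_)
        rw [smul_eq_mul, hczspan]
        rw [pow_two] at hq
        exact Ideal.mul_mono_left hĪzle hq
    · change cz 1 ∈ _
      exact Ideal.mem_sup_left (Ideal.subset_span ⟨1, rfl⟩)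
  -- a section `g₁` of `cz₁`, on an affine `V₂ ⊆ W` where it lies in `Ī`
  obtain ⟨U₁, hzU₁, s₁, hs₁⟩ := G₀.presheaf.exists_germ_eq (cz 1)
  obtain ⟨V₁', hV₁', hzV₁, hV₁le⟩ :=
    exists_isAffineOpen_mem_and_subset (X := G₀) (x := z) (U := (W : G₀.Opens) ⊓ U₁) ⟨hzW, hzU₁⟩
  let V₁ : G₀.affineOpens := ⟨V₁', hV₁'⟩
  have hV₁W : (V₁ : G₀.Opens) ≤ W := fun p hp => (hV₁le hp).1
  have hV₁U₁ : (V₁ : G₀.Opens) ≤ U₁ := fun p hp => (hV₁le hp).2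
  let g₁ : Γ(G₀, (V₁ : G₀.Opens)) := G₀.presheaf.map (homOfLE hV₁U₁).op s₁
  have hg₁z : (G₀.presheaf.germ (V₁ : G₀.Opens) z hzV₁).hom g₁ = cz 1 := by
    change (G₀.presheaf.germ _ z hzV₁).hom (G₀.presheaf.map (homOfLE hV₁U₁).op s₁) = cz 1
    rw [TopCat.Presheaf.germ_res_apply]; exact hs₁
  have hg₁mem : (G₀.presheaf.germ (V₁ : G₀.Opens) z hzV₁).hom g₁ ∈ stalkIdeal Ī z := by
    rw [hg₁z, ← hczspan]; exact Ideal.subset_span ⟨1, rfl⟩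
  obtain ⟨f, hzf, hf⟩ := exists_basicOpen_forall_germ_mem_stalkIdeal Ī V₁ hzV₁ g₁ hg₁mem
  let V₂ : G₀.affineOpens := ⟨G₀.basicOpen f, V₁.2.basicOpen f⟩
  have hV₂V₁ : (V₂ : G₀.Opens) ≤ V₁ := G₀.basicOpen_le f
  have hV₂W : (V₂ : G₀.Opens) ≤ W := hV₂V₁.trans hV₁W
  have hzV₂ : z ∈ (V₂ : G₀.Opens) := hzf
  set r : Γ(G₀, (W : G₀.Opens)) →+* Γ(G₀, (V₂ : G₀.Opens)) := (G₀.presheaf.map (homOfLE hV₂W).op).hom with hr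
  let g : Fin 2 → Γ(G₀, (V₂ : G₀.Opens)) := ![r d, G₀.presheaf.map (homOfLE hV₂V₁).op g₁]
  set ψ := (G₀.presheaf.germ (V₂ : G₀.Opens) z hzV₂).hom with hψ
  have hψr : ∀ t, ψ (r t) = φ t := fun t => TopCat.Presheaf.germ_res_apply G₀.presheaf (homOfLE hV₂W) z hzV₂ t
  have hψg : (fun j => ψ (g j)) = ![φ d, cz 1] := by
    funext j; fin_cases j
    · exact hψr d
    · change ψ (G₀.presheaf.map (homOfLE hV₂V₁).op g₁) = cz 1
      rw [hψ, TopCat.Presheaf.germ_res_apply]; exact hg₁z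
  have hgspan : Ideal.span (Set.range fun j => ψ (g j)) = stalkIdeal Ī z := by rw [hψg, hpair]
  have hg𝒟 : stalkIdeal 𝒟' z = Ideal.span {ψ (g 0)} ⊔ stalkIdeal Ī z ^ 2 := by
    rw [show ψ (g 0) = φ d from hψr d, h𝒟z]
  -- `g₁| ∈ Ī(V₂) = (x|)`: the coefficients `β`
  have hĪV₂ : Ī.ideal V₂ = Ideal.span (Set.range (r ∘ xW)) := by
    rw [← Ī.map_ideal (U := V₂) (V := W) hV₂W, hĪW, Ideal.map_span, ← Set.range_comp]
    rfl
  have hg1mem : g 1 ∈ Ī.ideal V₂ := by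
    rw [mem_ideal_iff_forall_germ_mem_stalkIdeal]
    intro y hy
    change (G₀.presheaf.germ _ y hy).hom (G₀.presheaf.map (homOfLE hV₂V₁).op g₁) ∈ _
    rw [TopCat.Presheaf.germ_res_apply]
    exact hf y hy
  obtain ⟨β, hβ⟩ : ∃ β : Fin 2 → Γ(G₀, (V₂ : G₀.Opens)), ∑ j, β j * (r ∘ xW) j = g 1 :=
    Ideal.mem_span_range_iff_exists_fun.mp (hĪV₂ ▸ hg1mem)
  let A0 : Matrix (Fin 2) (Fin 2) Γ(G₀, (V₂ : G₀.Opens)) := Matrix.of ![fun j => r (α j), β]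
  have hA0g : ∀ i, g i = ∑ j, A0 i j * r (xW j) := by
    intro i; fin_cases i
    · change r d = ∑ j, r (α j) * r (xW j)
      rw [hd, map_sum]
      exact Finset.sum_congr rfl fun j _ => by rw [map_mul]
    · change g 1 = ∑ j, β j * r (xW j)
      exact hβ.symm
  -- `det A0` is a unit at `z`
  have hdetz : IsUnit (ψ A0.det) := by
    have hxz : ∀ j, ∃ p : Fin 2 → G₀.presheaf.stalk z, ∑ l, p l * cz l = ψ (r (xW j)) := fun j =>
      Ideal.mem_span_range_iff_exists_fun.mp (by
        rw [hczspan, hψr, hĪz, hĪW, Ideal.map_span]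
        exact Ideal.subset_span ⟨xW j, ⟨j, rfl⟩, rfl⟩)
    choose p hp using hxz
    let P : Matrix (Fin 2) (Fin 2) (G₀.presheaf.stalk z) := Matrix.of p
    have hM : ∀ i, ∑ l, (A0.map ψ * P) i l * cz l = ψ (g i) := by
      intro i
      rw [hA0g i, map_sum]
      have e : ∀ j, ψ (A0 i j * r (xW j)) = ∑ l, ψ (A0 i j) * (P j l * cz l) := fun j => by
        rw [map_mul, ← hp j, Finset.mul_sum]
        exact Finset.sum_congr rfl fun l _ => rfl
      simp_rw [e, Matrix.mul_apply, Finset.sum_mul, Matrix.map_apply]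
      rw [Finset.sum_comm]
      exact Finset.sum_congr rfl fun j _ => Finset.sum_congr rfl fun l _ => by ring
    have hspan_eq : Ideal.span (Set.range fun j => ψ (g j)) = Ideal.span (Set.range cz) := by rw [hgspan, hczspan]
    have hu := isUnit_det_of_span_pair_eq_matrix hczqr (hczspan ▸ hĪzle) hspan_eq (A0.map ψ * P) hM
    rw [Matrix.det_mul] at hu
    have hu' := isUnit_of_mul_isUnit_left hu
    rwa [← RingHom.mapMatrix_apply, ← RingHom.map_det] at hu'
  have hzD : z ∈ G₀.basicOpen A0.det := (G₀.mem_basicOpen A0.det z hzV₂).mpr hdetz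
  -- spread the prescribed pair to an affine `W' ⊆ V₂ ∩ D(det A0)`
  obtain ⟨W', hzW', hW'V₂, hW'O, hcI, hcqr, hc𝒟⟩ := exists_affine_adaptedFrame_of_germs Ī 𝒟' hdir' z V₂ hzV₂ g hgspan hg𝒟
    ((V₂ : G₀.Opens) ⊓ G₀.basicOpen A0.det) ⟨hzV₂, hzD⟩
  set r' : Γ(G₀, (V₂ : G₀.Opens)) →+* Γ(G₀, (W' : G₀.Opens)) := (G₀.presheaf.map (homOfLE hW'V₂).op).hom with hr'
  have hrr' : ∀ t, r' (r t) = G₀.presheaf.map (homOfLE (hW'V₂.trans hV₂W)).op t := fun t => by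
    rw [hr', hr, ← CommRingCat.comp_apply, ← Functor.map_comp]
    rfl
  refine ⟨W', hzW', hW'V₂.trans hV₂W, A0.map r', fun j => r' (g j), ?_, ?_, ?_, hcI, hcqr, hc𝒟⟩
  · rw [← RingHom.mapMatrix_apply, ← RingHom.map_det]
    have hle : (W' : G₀.Opens) ≤ G₀.basicOpen A0.det := fun p hp => (hW'O hp).2
    have h2 : IsUnit ((G₀.presheaf.map (homOfLE (G₀.basicOpen_le A0.det)).op).hom A0.det) :=
      G₀.toRingedSpace.isUnit_res_basicOpen A0.det
    have h3 := h2.map (G₀.presheaf.map (homOfLE hle).op).hom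
    rw [← CommRingCat.comp_apply, ← Functor.map_comp] at h3
    exact h3
  · intro j
    change r' (r (α j)) = _
    exact hrr' (α j)
  · intro i
    change r' (g i) = _
    rw [hA0g i, map_sum]
    refine Finset.sum_congr rfl fun j _ => ?_
    rw [map_mul, Matrix.map_apply, hrr' (xW j)]

end Summit.ResolutionOfSingularities.ResolutionOfSingularities.Cruxes.EquisingularLiftNat.Sections

end
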